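import Summits.QuantumFields.BalabanUV.T4Continuum.Support.NE7SliceOrbitNL0
import Summits.QuantumFields.BalabanUV.T4Continuum.Support.NE7SliceInitialStateNL0
import Summits.QuantumFields.BalabanUV.T4Continuum.Support.NE7SliceLimitNLR0
import HarnessLib

/-!
# [(R1″) FRAME-FREE PORT — memo ROAD-G103 §6: VERBATIM `NE7SliceTheoremNL` with row NE3's `rightInvW` replaced by `NE7FrameFreeRightInverse.rightInvW0` (`dirIter R₀ = id`, `framePotW R₀ = 0` exactly),
# constants `supC ↦ supC0`, `supCurlC ↦ supCurlC0`, one extra def-parameter `hE`; right-inverse-independent lemmas are imported from `NE7SliceTheoremNL` BY NAME, not restated.]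
# NE7SliceTheoremNL0 — THE NONLINEAR SLICE THEOREM ON THE NONLINEAR FRAME TARGET (memo ROAD-G103 §3, (R1′), file (B2)-8 = (S1)-NL): from the near-representative `u₀` the iteration
# `u ↦ e^{−ζ̃(u)}u` converges to a unitary `(tower)`-periodic `u⋆` with chart `U′^{u⋆} = W·e^{X⋆}`, `M·‖X⋆‖ ≤ S`, corners `u⋆(M•z) = e^{h⋆ z}`, `‖h⋆‖ ≤ S`, `T̃(u⋆) ∈ 𝒯_E(W)`, and
# **`mlog v_{k+1}(X⋆) = h⋆ + framePotW Ñ(u⋆)`** — [Balaban1985Averaging] (92)∕(97)'s NONLINEAR accumulated frame matched to the corner transformation up to the N-frame ((1.37) up to `Ñ`) —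
# and `D̃f(u⋆) = 0`; assembly of `NE7SliceInitialStateNL0` + `NE7SliceOrbitNL0.slice_orbit_w_nl` + NE7b's `NE7SliceLimitNLR0.limitNLR_of_geometric_reg`, the NL facts fed from
# `NE7SliceIterationStateFactsNL0` and `hLP` from (LP′) `NE7FrameDefectLipschitzRadius`

Cell `pub-balaban`, rung (B)+1 sub-cell t4, lineage `b2b-balaban-t4-ne7-p1`, generation 103 (CRUX PROVER NE7 #1 = OWNER of BINDER row NE7).  Memo `t4/b2b-balaban-t4-ne7-p1-g103/ROAD-G103.md` §3∕§5.
WHAT ([folklore]; 0 def, 0 sorry).  **`slice_theorem_nl`** (statement displayed: the curved sup letter (L) as `hLet`, B7's Prop-4 regime for `W`, `U′` at the radius `b₁` (orbit) and at `2b` (initial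
state), the k-uniform two-radius regime with the currency `τ + ω`, `ω ≥ 4C_Γ·M·b₁`, lines `2S + 6Mδ₀ ≤ Mb₁`, `6S ≤ Mb₁`).
HONEST FRAMING (page 1): assembly of landed kernel theorems; nothing of Bałaban's asserted; NOT (S2)-NL (the letters for `φ̃⋆`), NOT NE7; spine 0∕9; finite T⁴ rung (B)+1 — NOT infinite volume, NOT mass
gap, NOT BetaPertH, NOT Clay (continuum YM on T⁴ ⇐ BetaPertH ∧ nine spine estimates, 0/9 proved).
-/

set_option autoImplicit false

open scoped BigOperators Matrix.Norms.L2Operator Topology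
open NormedSpace Finset Filter

namespace Summit.QuantumFields.BalabanUV.T4Continuum.NE7SliceTheoremNL0

open Literature.MathematicalPhysics.QuantumFieldTheory.Balaban1983to89
open B7Prop1Explicit B7Prop2Explicit B7Prop3Flat MatrixLog
open B7Eq92Concrete (vcov)
open T4AveragingDeficitWall (IsUnitaryCfg IsSkewDir SmallField vary curlAt)
open T4AveragingDeficitWallBoundary (IsPeriodicCfg periodBox)
open AveragingDeficitPeriodicCounting (IsPeriodicDir)
open AveragingDeficitTwoLevelPrep (prop1Radius)
open AveragingDeficitMultiLevelPrep (cavgIter LevelSmall tower)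
open BlockAveragePushDirGauge (gaugeDir)
open NE3EnergyShapes (IsUnitarySite IsPeriodicSite)
open NE3RightInverseSupLetters (frameC supC)
open NE3HatInvCurlLetters (supCurlC)
open NE3QbarIterCovLiftPrep (cruxC)
open NE7FrameFreeRightInverse (rightInvW0 supC0 supCurlC0 supC0_nonneg norm_rightInvW0_le norm_curlAt_rightInvW0_le framePotW_rightInvW0)
open NE3LinearisedAverageSup (curvSum)
open NE3TangentCovariantTower (framePotW)
open NE3.PairLandauB8Avg (relPert)
open NE7MeanZeroGaugeSliceW (energyBlockLandauW)
open SpreadLift (loopRad)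
open NE7SliceIterationState (repLog cornerLog sizePair)
open NE7SliceIterationStateNL0
open NE7SliceIterationStateNL (frameDefect effCornerLog coarseDatumNL coarseDatumNL_eq effCornerLog_add_frameDefect)
open NE7SliceIterationStateFactsNL0 (splitNL0_exists frameNL0_periodic)
open NE7SliceIterationStateFactsNL (coarseDatumNL_skew_periodic)
open NE7SliceIterationOrbit (region_sizes)
open NE7SliceIterationOrbitWeighted (weighted_region)
open NE7SliceOrbitNL0 (slice_orbit_w_nl)
open NE7SliceInitialState (init_chart init_corner init_weighted_size init_norm_repLog_le)
open NE7SliceInitialStateNL0 (init_sliceDefectNL0_le)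
open NE7FrameDefectLipschitzRadius (norm_frameDefect_sub_frameDefect_le_of_radius)
open NE7SliceLimitNLR0 (limitNLR_of_geometric_reg)

noncomputable section

variable {d : ℕ} {n : Type*} [Fintype n] [DecidableEq n]

section Slice

variable [Nonempty n] {L : ℕ} (hL : 2 ≤ L) (k : ℕ) {W : Site d → Fin d → (Matrix n n ℂ)ˣ} {x : ℝ} (hWu : IsUnitaryCfg W) (hx : 0 ≤ x) (hs : LevelSmall d L k x)
  (hWx : SmallField W x) (N : ℕ) [NeZero N] (hθ : cruxC d L * (((L : ℝ) ^ (k + 1)) ^ 2 * x) < 1)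
  (hE : 4 * (d : ℝ) ^ 2 * ((L : ℝ) ^ (k + 1) - 1) ^ 2 * x + 16 * d * loopRad d L ((prop1Radius d L)^[k] x) ≤ 1 / 2) (U' : Site d → Fin d → (Matrix n n ℂ)ˣ)
  (hWP : IsPeriodicCfg W ((tower L N (k + 1) : ℕ) : ℤ)) (hU'u : IsUnitaryCfg U') (hU'P : IsPeriodicCfg U' ((tower L N (k + 1) : ℕ) : ℤ))
  -- B7's Prop-4 regime at level `k+1` for `W` and `U′`: α-lines, the ORBIT radius `b₁`, the INITIAL radius `2b`, the frame-defect currency `ω`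
  (hd : 1 ≤ d) (κ₀ : Fin d) {α₀ αP x' b b₁ ω : ℝ} (hα : 0 < α₀) (hα3 : C0 d * α₀ ≤ 1 / 3) (hα4 : 4 * α₀ ≤ c2' d L) (h52 : pdev W < α₀ * (((L : ℝ) ^ (k + 1))⁻¹) ^ 2)
  (hsmall : Real.exp (4 * (800 * ((d : ℝ) + 1) ^ 2 * ((d : ℝ) + 4)) * α₀) * (1 + 8 * (131072 * ((d : ℝ) + 1) ^ 2) * ((L : ℝ) ^ (k + 1) * b₁)) ≤ 2)
  (hc₃ : 2 * ((L : ℝ) ^ (k + 1) * b₁) ≤ c3 d L) (h100 : 100 * ((d : ℝ) * L * ((L : ℝ) ^ (k + 1) * b₁)) ≤ 1)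
  (hC16 : 16 * (131072 * ((d : ℝ) + 1) ^ 2) * ((L : ℝ) ^ (k + 1) * b₁) ≤ 1) (hsm : 2048 * (d : ℝ) * ((L : ℝ) ^ (k + 1) * b₁) ≤ 1)
  (hsmall2 : Real.exp (4 * (800 * ((d : ℝ) + 1) ^ 2 * ((d : ℝ) + 4)) * α₀) * (1 + 8 * (131072 * ((d : ℝ) + 1) ^ 2) * ((L : ℝ) ^ (k + 1) * (2 * b))) ≤ 2)
  (hc₃2 : 2 * ((L : ℝ) ^ (k + 1) * (2 * b)) ≤ c3 d L) (h1002 : 100 * ((d : ℝ) * L * ((L : ℝ) ^ (k + 1) * (2 * b))) ≤ 1)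
  (hC162 : 16 * (131072 * ((d : ℝ) + 1) ^ 2) * ((L : ℝ) ^ (k + 1) * (2 * b)) ≤ 1) (hsm2 : 2048 * (d : ℝ) * ((L : ℝ) ^ (k + 1) * (2 * b)) ≤ 1)
  (hαP : 0 < αP) (hαP3 : C0 d * αP ≤ 1 / 3) (hαP2 : 2 * αP ≤ c2' d L) (hx'0 : 0 ≤ x') (hU'x : SmallField U' x') (hx'P : x' < αP * (((L : ℝ) ^ (k + 1))⁻¹) ^ 2)
  (hω0 : 0 ≤ ω) (hβ : 4 * (56 * ((d : ℝ) * L) ^ 2 + 16 * (131072 * ((d : ℝ) + 1) ^ 2) * ((d : ℝ) * L)) * ((L : ℝ) ^ (k + 1) * b₁) ≤ ω)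

include hWP hU'u hU'P hd κ₀ hα hα3 hα4 h52 hsmall hc₃ h100 hC16 hsm hsmall2 hc₃2 h1002 hC162 hsm2 hαP hαP3 hαP2 hx'0 hU'x hx'P hω0 hβ in
/-- **THE NONLINEAR SLICE THEOREM ON THE NONLINEAR FRAME TARGET, (S1)-NL.**  Class at `W` (as `NE7SliceTheorem.slice_theorem`), (L) displayed as `hLet` (`K ≥ 0`, `16Kd·M²x ≤ 1∕2`),
REGIME `0 ≤ τ`, `τ + ω ≤ 1`, `30000dτ ≤ 1`, `3·10⁶(1+16K)(1+d)³(1+frameC)(1+supC+supCurlC)·(τ+ω) ≤ 1∕2`, `M²x, M²x′ ≤ τ`; the near-representative `u₀` (unitary, `(tower)`-periodic, corner-trivial,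
`‖W(b)⁻¹U′^{u₀}(b) − 1‖ ≤ b ≤ 1∕64`) with its NL defect ceiling `δ₀` (`init_sliceDefectNL0_le`'s bound `≤ δ₀`, `6dMδ₀ ≤ 10⁻⁴`, `Mδ₀ ≤ τ`), size ceiling `S` (`2Mb + 24dMδ₀ ≤ S ≤ 10⁻⁴`, `S ≤ τ`),
radius lines `2S + 6Mδ₀ ≤ Mb₁`, `6S ≤ Mb₁`.  CONCLUSION: `u⋆` unitary `(tower)`-periodic, chart, `M‖X(u⋆)‖ ≤ S`, corners, `‖h(u⋆)‖ ≤ S`, `T̃(u⋆) ∈ 𝒯_E(W)`,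
`mlog v_{k+1}(X(u⋆)) = h(u⋆) + framePotW Ñ(u⋆)`, `D̃f(u⋆) = 0`. [folklore] -/
theorem slice_theorem_nl
    (hθP : 4 * (d : ℝ) ^ 2 * ((L : ℝ) ^ (k + 1) - 1) ^ 2 * x + 16 * d * loopRad d L ((prop1Radius d L)^[k] x)
      + 4 * d * ((d : ℝ) - 1) * ((L : ℝ) ^ (k + 1) - 1) ^ 2 * x ≤ 1 / 2)
    {K : ℝ} (hK : 0 ≤ K) (hKε : 16 * K * d * (((L : ℝ) ^ (k + 1)) ^ 2 * x) ≤ 1 / 2)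
    (hLet : ∀ Y : Site d → Fin d → Matrix n n ℂ, Y ∈ energyBlockLandauW (d := d) (n := n) L N (k + 1) W →
      ∀ B : ℝ, (∀ (z : Site d) (μ ν : Fin d), μ ≠ ν → ‖curlAt W Y z μ ν‖ ≤ B) → ∀ (y : Site d) (κ : Fin d), ‖Y y κ‖ ≤ K * (L : ℝ) ^ (k + 1) * B)
    (hε : ((L : ℝ) ^ (k + 1)) ^ 2 * x ≤ 1) (hA : curvSum d L (k + 1) x ≤ 2 / 3 * L) (hθc : cruxC d L * (((L : ℝ) ^ (k + 1)) ^ 2 * x) ≤ 1 / 2)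
    {τ : ℝ} (hτ0 : 0 ≤ τ) (hτ1 : τ + ω ≤ 1) (hτs : 30000 * (d : ℝ) * τ ≤ 1)
    (hC : 3000000 * (1 + 16 * K) * (1 + (d : ℝ)) ^ 3 * (1 + frameC d L) * (1 + supC0 d L + supCurlC0 d L) * (τ + ω) ≤ 1 / 2)
    (h4 : ((L : ℝ) ^ (k + 1)) ^ 2 * x ≤ τ) (h5 : ((L : ℝ) ^ (k + 1)) ^ 2 * x' ≤ τ)
    {u₀ : Site d → (Matrix n n ℂ)ˣ} (hu₀ : IsUnitarySite u₀) (hu₀P : IsPeriodicSite u₀ ((tower L N (k + 1) : ℕ) : ℤ))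
    (hpin : ∀ z : Site d, u₀ ((((L : ℤ) ^ (k + 1))) • z) = 1)
    (hb : ∀ (y : Site d) (κ : Fin d), ‖(((W y κ)⁻¹ * gaugeAct u₀ U' y κ : (Matrix n n ℂ)ˣ) : Matrix n n ℂ) - 1‖ ≤ b) (hb64 : b ≤ 1 / 64)
    {eE cE ec δ₀ S : ℝ}
    (heE : 2 * b + supC0 d L / ((L : ℝ) ^ (k + 1) * (1 - cruxC d L * (((L : ℝ) ^ (k + 1)) ^ 2 * x)))
        * ((3 + 12 * (d : ℝ)) * (L : ℝ) ^ (k + 1) * (2 * b) + 2 * ((56 * ((d : ℝ) * L) ^ 2 + 16 * (131072 * ((d : ℝ) + 1) ^ 2) * ((d : ℝ) * L)) * ((L : ℝ) ^ (k + 1) * (2 * b)) ^ 2)) ≤ eE)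
    (hcE : (x + x' + 48 * (2 * b) ^ 2) + supCurlC0 d L / (((L : ℝ) ^ (k + 1)) ^ 2 * (1 - cruxC d L * (((L : ℝ) ^ (k + 1)) ^ 2 * x)))
        * ((3 + 12 * (d : ℝ)) * (L : ℝ) ^ (k + 1) * (2 * b) + 2 * ((56 * ((d : ℝ) * L) ^ 2 + 16 * (131072 * ((d : ℝ) + 1) ^ 2) * ((d : ℝ) * L)) * ((L : ℝ) ^ (k + 1) * (2 * b)) ^ 2)) ≤ cE)
    (hec : (56 * ((d : ℝ) * L) ^ 2 + 16 * (131072 * ((d : ℝ) + 1) ^ 2) * ((d : ℝ) * L)) * ((L : ℝ) ^ (k + 1) * (2 * b)) ^ 2 ≤ ec)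
    (hδ₀ : (eE + (2 * K * (L : ℝ) ^ (k + 1) * cE + 8 * K * (((L : ℝ) ^ (k + 1)) ^ 2 * x) * (frameC d L * (L : ℝ) ^ (k + 1) * eE + ec) / (L : ℝ) ^ (k + 1)
          + 16 * K * d * (((L : ℝ) ^ (k + 1)) ^ 2 * x) * eE)) + (frameC d L * (L : ℝ) ^ (k + 1) * eE + ec) / (L : ℝ) ^ (k + 1) ≤ δ₀)
    (hδmax : 6 * (d : ℝ) * (L : ℝ) ^ (k + 1) * δ₀ ≤ 1 / 10000) (hMδ : (L : ℝ) ^ (k + 1) * δ₀ ≤ τ)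
    (hSsum : 2 * (L : ℝ) ^ (k + 1) * b + 24 * d * (L : ℝ) ^ (k + 1) * δ₀ ≤ S) (hS4 : S ≤ 1 / 10000) (hSτ : S ≤ τ)
    (hSb : 2 * S + 6 * ((L : ℝ) ^ (k + 1) * δ₀) ≤ (L : ℝ) ^ (k + 1) * b₁) (h6S : 6 * S ≤ (L : ℝ) ^ (k + 1) * b₁) :
    ∃ ustar : Site d → (Matrix n n ℂ)ˣ, IsUnitarySite ustar ∧ IsPeriodicSite ustar ((tower L N (k + 1) : ℕ) : ℤ) ∧
      gaugeAct ustar U' = vary W (repLog W U' ustar) 1 ∧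
      (∀ (y : Site d) (κ : Fin d), (L : ℝ) ^ (k + 1) * ‖repLog W U' ustar y κ‖ ≤ S) ∧
      (∀ z : Site d, ((ustar ((((L : ℤ) ^ (k + 1))) • z) : (Matrix n n ℂ)ˣ) : Matrix n n ℂ) = exp (cornerLog L k ustar z)) ∧
      (∀ z : Site d, ‖cornerLog L k ustar z‖ ≤ S) ∧
      tangentPartNL0 hL k hWu hx hs hWx N hθ hE U' ustar ∈ energyBlockLandauW (d := d) (n := n) L N (k + 1) W ∧
      (∀ z, mlog ((vcov L W (relPert W (repLog W U' ustar)) (k + 1) z : (Matrix n n ℂ)ˣ) : Matrix n n ℂ)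
        = cornerLog L k ustar z + framePotW L (k + 1) W (normalPartNL0 hL k hWu hx hs hWx N hθ hE U' ustar) z) ∧
      (∀ z, mlog ((vcov L W (relPert W (repLog W U' ustar)) (k + 1) z : (Matrix n n ℂ)ˣ) : Matrix n n ℂ) = cornerLog L k ustar z) ∧
      sliceDefectNL0 hL k hWu hx hs hWx N hθ hE U' ustar = 0 := by
  have hd0 : 0 < d := hd
  have hM0 : 0 < (L : ℝ) ^ (k + 1) := by positivity
  have hM1 : (1 : ℝ) ≤ (L : ℝ) ^ (k + 1) := one_le_pow₀ (by exact_mod_cast (by omega : 1 ≤ L))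
  have hb0 : 0 ≤ b := (norm_nonneg _).trans (hb 0 κ₀)
  -- the initial state
  have hchart₀ := init_chart U' hb hb64 (u₀ := u₀)
  have hcorner₀ := init_corner k hpin (u₀ := u₀)
  have hs₀ := init_weighted_size hL k N U' hpin hb hb64 hd0 (W := W)
  have hd₀ := (init_sliceDefectNL0_le hL k hWu hx hs hWx N hθ hE U' hWP hU'u hU'P hu₀ hu₀P hpin hb hb64 hd hα hα3 hα4 h52 hsmall2 hc₃2 h1002 hC162 hsm2 hαP hαP3 hαP2 hx'0 hU'x hx'P
    hθP hK hKε hLet hε hA heE hcE hec).trans hδ₀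
  have hδ₀0 : 0 ≤ δ₀ := (sliceDefectNL0_nonneg hL k hWu hx hs hWx N hθ hE U' u₀).trans hd₀
  have hSsum' : 2 * (L : ℝ) ^ (k + 1) * b + 12 * d * (L : ℝ) ^ (k + 1) * δ₀ / (1 - 1 / 2) ≤ S := by
    have e : 12 * (d : ℝ) * (L : ℝ) ^ (k + 1) * δ₀ / (1 - 1 / 2) = 24 * d * (L : ℝ) ^ (k + 1) * δ₀ := by ring
    rw [e]; exact hSsum
  -- the orbit
  obtain ⟨ustar, hlu, hlP, hconv, hrate, horbit⟩ := slice_orbit_w_nl hL k hWu hx hs hWx N hθ hE U' hWP hU'u hU'P hd κ₀ hα hα3 hα4 h52 hsmall hc₃ h100 hC16 hsm hαP hαP3 hαP2 hx'0 hU'x hx'P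
    hω0 hβ hθP hK hKε hLet hε hA hθc hτ0 hτ1 hτs hC hS4 hSτ hδmax hMδ h4 h5 hSb hu₀ hu₀P hchart₀ hcorner₀ hδ₀0 le_rfl hs₀ hd₀ hSsum'
  -- per-j working-region facts
  have hreg : ∀ j, (∀ y κ, (L : ℝ) ^ (k + 1) * ‖repLog W U' ((sliceStepNL0 hL k hWu hx hs hWx N hθ hE U')^[j] u₀) y κ‖ ≤ S) ∧ (∀ z, ‖cornerLog L k ((sliceStepNL0 hL k hWu hx hs hWx N hθ hE U')^[j] u₀) z‖ ≤ S) := fun j => by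
    obtain ⟨⟨-, hjP, -, -, -⟩, -, hΦ⟩ := horbit j
    obtain ⟨hX, hh, h10, -, -, -⟩ := region_sizes hL k N U' hWP hU'P hjP
    obtain ⟨h1, -, h2⟩ := weighted_region hL k N U' (hΦ.trans hSsum')
    exact ⟨fun y κ => (mul_le_mul_of_nonneg_left (hX y κ) hM0.le).trans h1, fun z => (hh z).trans h2⟩
  have hXs : ∀ j y κ, ‖repLog W U' ((sliceStepNL0 hL k hWu hx hs hWx N hθ hE U')^[j] u₀) y κ‖ ≤ S / (L : ℝ) ^ (k + 1) := fun j y κ => by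
    rw [le_div_iff₀ hM0, mul_comm]; exact (hreg j).1 y κ
  have hS00 : 0 ≤ S := le_trans (by positivity) ((hreg 0).1 0 κ₀)
  have hSM : S / (L : ℝ) ^ (k + 1) ≤ S := div_le_self hS00 hM1
  have hXu : ∀ j y κ, ‖repLog W U' ((sliceStepNL0 hL k hWu hx hs hWx N hθ hE U')^[j] u₀) y κ‖ ≤ 1 / 8 := fun j y κ => ((hXs j y κ).trans hSM).trans (by linarith only [hS4])
  have hhu : ∀ j z, ‖cornerLog L k ((sliceStepNL0 hL k hWu hx hs hWx N hθ hE U')^[j] u₀) z‖ ≤ 1 / 8 := fun j z => ((hreg j).2 z).trans (by linarith only [hS4])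
  have hju : ∀ j, IsUnitarySite ((sliceStepNL0 hL k hWu hx hs hWx N hθ hE U')^[j] u₀) := fun j => (horbit j).1.1
  have hjP : ∀ j, IsPeriodicSite ((sliceStepNL0 hL k hWu hx hs hWx N hθ hE U')^[j] u₀) ((tower L N (k + 1) : ℕ) : ℤ) := fun j => (horbit j).1.2.1
  have hgu : ∀ j, gaugeAct ((sliceStepNL0 hL k hWu hx hs hWx N hθ hE U')^[j] u₀) U' = vary W (repLog W U' ((sliceStepNL0 hL k hWu hx hs hWx N hθ hE U')^[j] u₀)) 1 := fun j => (horbit j).1.2.2.1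
  have hcu : ∀ j z, (((((sliceStepNL0 hL k hWu hx hs hWx N hθ hE U')^[j] u₀)) ((((L : ℤ) ^ (k + 1))) • z) : (Matrix n n ℂ)ˣ) : Matrix n n ℂ) = exp (cornerLog L k ((sliceStepNL0 hL k hWu hx hs hWx N hθ hE U')^[j] u₀) z) :=
    fun j => (horbit j).1.2.2.2.1
  have hDf : ∀ j, sliceDefectNL0 hL k hWu hx hs hWx N hθ hE U' ((sliceStepNL0 hL k hWu hx hs hWx N hθ hE U')^[j] u₀) ≤ (1 / 2) ^ j * δ₀ := fun j => (horbit j).2.1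
  have hrate' : ∀ j y, ‖((((sliceStepNL0 hL k hWu hx hs hWx N hθ hE U')^[j] u₀) y : (Matrix n n ℂ)ˣ) : Matrix n n ℂ) - (ustar y : (Matrix n n ℂ)ˣ)‖ ≤ (12 * d * (L : ℝ) ^ (k + 1) * δ₀ / (1 - 1 / 2)) * (1 / 2) ^ j := fun j y => by
    have h := hrate y j
    have e : 12 * (d : ℝ) * (L : ℝ) ^ (k + 1) * δ₀ * (1 / 2) ^ j / (1 - 1 / 2) = (12 * d * (L : ℝ) ^ (k + 1) * δ₀ / (1 - 1 / 2)) * (1 / 2) ^ j := by ring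
    rw [e] at h; exact h
  -- the regime radius dominates the orbit: `S/M ≤ b₁/6`, `0 ≤ b₁`
  have hb06 : 6 * (S / (L : ℝ) ^ (k + 1)) ≤ b₁ := by
    rw [mul_div_assoc', div_le_iff₀ hM0]; linarith only [h6S, mul_comm b₁ ((L : ℝ) ^ (k + 1))]
  have hS0 : 0 ≤ S / (L : ℝ) ^ (k + 1) := (norm_nonneg _).trans (hXs 0 0 κ₀)
  have hb₁0 : 0 ≤ b₁ := by linarith only [hb06, hS0]
  -- the NL state facts on the regime-sized working region (`b := b₁ ≥ S/M`)
  have hskewNL : ∀ w : Site d → (Matrix n n ℂ)ˣ, IsUnitarySite w → IsPeriodicSite w ((tower L N (k + 1) : ℕ) : ℤ) → gaugeAct w U' = vary W (repLog W U' w) 1 →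
      (∀ y κ, ‖repLog W U' w y κ‖ ≤ 1 / 8) → (∀ z, ((w ((((L : ℤ) ^ (k + 1))) • z) : (Matrix n n ℂ)ˣ) : Matrix n n ℂ) = exp (cornerLog L k w z)) →
      (∀ z, ‖cornerLog L k w z‖ ≤ 1 / 8) → (∀ y κ, ‖repLog W U' w y κ‖ ≤ S / (L : ℝ) ^ (k + 1)) → IsSkewDir (coarseDatumNL L k W U' w) :=
    fun w hw hwP hgw hX8 hcw hh8 hXb =>
      (coarseDatumNL_skew_periodic hL k hWu hx hs hWx N U' hWP hU'u hU'P hw hwP hgw hX8 hcw hh8 hd hα hα3 hα4 h52 hb₁0 (fun y κ => (hXb y κ).trans (by linarith only [hb06, hS0]))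
        hsmall hc₃ hsm hαP hαP3 hαP2 hx'0 hU'x hx'P).1
  have hsplitNL : ∀ w : Site d → (Matrix n n ℂ)ˣ, IsUnitarySite w → IsPeriodicSite w ((tower L N (k + 1) : ℕ) : ℤ) → gaugeAct w U' = vary W (repLog W U' w) 1 →
      (∀ y κ, ‖repLog W U' w y κ‖ ≤ 1 / 8) → (∀ z, ((w ((((L : ℤ) ^ (k + 1))) • z) : (Matrix n n ℂ)ˣ) : Matrix n n ℂ) = exp (cornerLog L k w z)) →
      (∀ z, ‖cornerLog L k w z‖ ≤ 1 / 8) → (∀ y κ, ‖repLog W U' w y κ‖ ≤ S / (L : ℝ) ^ (k + 1)) → ∃ p : (Site d → Matrix n n ℂ) × (Site d → Fin d → Matrix n n ℂ),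
        NE7SliceIterationState.IsNormalisedSplit L k N W (tangentPartNL0 hL k hWu hx hs hWx N hθ hE U' w) (effCornerLog L k W U' w) p.1 p.2 :=
    fun w hw hwP hgw hX8 hcw hh8 hXb =>
      splitNL0_exists hL k hWu hx hs hWx N hθ hE U' hWP hU'u hU'P hw hwP hgw hX8 hcw hh8 hd hα hα3 hα4 h52 hb₁0 (fun y κ => (hXb y κ).trans (by linarith only [hb06, hS0]))
        hsmall hc₃ hsm hαP hαP3 hαP2 hx'0 hU'x hx'P
  have hperNL : ∀ w : Site d → (Matrix n n ℂ)ˣ, IsUnitarySite w → IsPeriodicSite w ((tower L N (k + 1) : ℕ) : ℤ) → gaugeAct w U' = vary W (repLog W U' w) 1 →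
      (∀ y κ, ‖repLog W U' w y κ‖ ≤ 1 / 8) → (∀ z, ((w ((((L : ℤ) ^ (k + 1))) • z) : (Matrix n n ℂ)ˣ) : Matrix n n ℂ) = exp (cornerLog L k w z)) →
      (∀ z, ‖cornerLog L k w z‖ ≤ 1 / 8) → (∀ y κ, ‖repLog W U' w y κ‖ ≤ S / (L : ℝ) ^ (k + 1)) → ∀ (z : Site d) (i : Fin d),
        framePotW L (k + 1) W (tangentPartNL0 hL k hWu hx hs hWx N hθ hE U' w) (z + (N : ℤ) • e i) - effCornerLog L k W U' w (z + (N : ℤ) • e i)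
          = framePotW L (k + 1) W (tangentPartNL0 hL k hWu hx hs hWx N hθ hE U' w) z - effCornerLog L k W U' w z :=
    fun w hw hwP hgw hX8 hcw hh8 hXb =>
      frameNL0_periodic hL k hWu hx hs hWx N hθ hE U' hWP hU'u hU'P hw hwP hgw hX8 hcw hh8 hd hα hα3 hα4 h52 hb₁0 (fun y κ => (hXb y κ).trans (by linarith only [hb06, hS0]))
        hsmall hc₃ hsm hαP hαP3 hαP2 hx'0 hU'x hx'P
  -- (LP) on the radius `S/M`: from (LP′) at the regime radius `b₁ ≥ 6·(S/M)`
  have hKP : 0 ≤ 4 * (56 * ((d : ℝ) * L) ^ 2 + 16 * (131072 * ((d : ℝ) + 1) ^ 2) * ((d : ℝ) * L)) * ((L : ℝ) ^ (k + 1)) ^ 2 * b₁ := by positivity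
  have hLP : ∀ (X X' : Site d → Fin d → Matrix n n ℂ) (bX : ℝ), (∀ y κ, ‖X y κ‖ ≤ S / (L : ℝ) ^ (k + 1)) → (∀ y κ, ‖X' y κ‖ ≤ S / (L : ℝ) ^ (k + 1)) → 0 ≤ bX →
      (∀ y κ, ‖X y κ - X' y κ‖ ≤ bX) → ∀ z : Site d,
        ‖(mlog ((vcov L W (relPert W X) (k + 1) z : (Matrix n n ℂ)ˣ) : Matrix n n ℂ) - framePotW L (k + 1) W X z)
            - (mlog ((vcov L W (relPert W X') (k + 1) z : (Matrix n n ℂ)ˣ) : Matrix n n ℂ) - framePotW L (k + 1) W X' z)‖ ≤ (4 * (56 * ((d : ℝ) * L) ^ 2 + 16 * (131072 * ((d : ℝ) + 1) ^ 2) * ((d : ℝ) * L)) * ((L : ℝ) ^ (k + 1)) ^ 2 * b₁) * bX := by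
    intro X X' bX hX hX' hbX hD z
    -- difference bound `min(bX, 2·S/M)` realised as `δ := bX ⊓ (2 S/M)`
    have hD' : ∀ y κ, ‖X y κ - X' y κ‖ ≤ min bX (2 * (S / (L : ℝ) ^ (k + 1))) := fun y κ =>
      le_min (hD y κ) ((norm_sub_le _ _).trans (by linarith only [hX y κ, hX' y κ]))
    have hδ0 : 0 ≤ min bX (2 * (S / (L : ℝ) ^ (k + 1))) := le_min hbX (by linarith only [hS0])
    have hrad : 2 * (S / (L : ℝ) ^ (k + 1) + min bX (2 * (S / (L : ℝ) ^ (k + 1)))) ≤ b₁ := by linarith only [min_le_right bX (2 * (S / (L : ℝ) ^ (k + 1))), hb06]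
    have h := norm_frameDefect_sub_frameDefect_le_of_radius hL k hWu hα hα3 hα4 h52 κ₀ hx hs hWx (X := X') (X' := X) hS0 hδ0 hX'
      hD' hrad hsmall hc₃ h100 hC16 hsm z
    refine h.trans ?_
    exact mul_le_mul_of_nonneg_left (min_le_left _ _) hKP
  -- the one-call limit (NE7b)
  obtain ⟨⟨hgl, -, hcl⟩, ⟨hXl, hhl⟩, hT, -, hv, -, -, hDf0⟩ := limitNLR_of_geometric_reg hL k hWu hx hs hWx N hθ hE U' hWP hU'u hU'P hε hA hKP hLP hskewNL hsplitNL hperNL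
    (fun j => (sliceStepNL0 hL k hWu hx hs hWx N hθ hE U')^[j] u₀) ustar hju hjP hgu hXu hXs hcu hhu (sX := S / (L : ℝ) ^ (k + 1)) (sh := S) hXs (fun j z => (hreg j).2 z) hlu hlP hconv
    (by norm_num : (0 : ℝ) ≤ 1 / 2) (by norm_num : (1 / 2 : ℝ) < 1) hrate' hDf
  -- (1.37) EXACTLY: the frame-free right inverse kills `framePotW Ñ(u⋆)`
  have hX8l : ∀ y κ, ‖repLog W U' ustar y κ‖ ≤ 1 / 8 := fun y κ => ((hXl y κ).trans hSM).trans (by linarith only [hS4])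
  have hh8l : ∀ z, ‖cornerLog L k ustar z‖ ≤ 1 / 8 := fun z => (hhl z).trans (by linarith only [hS4])
  have hφl := (coarseDatumNL_skew_periodic hL k hWu hx hs hWx N U' hWP hU'u hU'P hlu hlP hgl hX8l hcl hh8l hd hα hα3 hα4 h52 hb₁0
    (fun y κ => (hXl y κ).trans (by linarith only [hb06, hS0])) hsmall hc₃ hsm hαP hαP3 hαP2 hx'0 hU'x hx'P).1
  have hv0 : ∀ z, mlog ((vcov L W (relPert W (repLog W U' ustar)) (k + 1) z : (Matrix n n ℂ)ˣ) : Matrix n n ℂ) = cornerLog L k ustar z := fun z => by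
    rw [hv z, normalPartNL0_eq hL k hWu hx hs hWx N hθ hE U' hφl, framePotW_rightInvW0 hL k hWu hx hs hWx N hθ hE hφl hWP κ₀ z, add_zero]
  refine ⟨ustar, hlu, hlP, hgl, fun y κ => ?_, hcl, hhl, hT, hv, hv0, hDf0⟩
  have := hXl y κ
  rwa [le_div_iff₀ hM0, mul_comm] at this

end Slice

end

end Summit.QuantumFields.BalabanUV.T4Continuum.NE7SliceTheoremNL0
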